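import Literature.NumberTheory.Sieve.PolymathLcmSumsProofs
import Literature.NumberTheory.Sieve.Maynard2016Growth

/-!
# Maynard (2016), Lemma 6: `ζ_W(1+u) = (1+o(1)) (W/φ(W)) / u` for `W = P_w` ((6.15), (6.17))

Trunk: AntSieve / parity (Maynard 2016 large-gaps ladder, named fact
`Literature.NumberTheory.Sieve.Maynard2016.Lemma6MainTerm` of `Maynard2016Lemma6Split.lean`).

J. Maynard, *Large gaps between primes*, Ann. of Math. 183 (2016) = arXiv:1408.5110, §6, proof of
Lemma 6, p. 10: "In the region `|z| = o(1)`, we have the estimate `ζ(1+z) = (1+o(1))/z`" ((6.17))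
together with (6.15), "since `log w = o((log x)^ε)` we have `∏_{p ≤ w} ∏_ℓ (…) = (1+o_k(1)) ∏_{p<w}(1−1/p)^{2k}`".
Both are packaged, as in the tree's Polymath 8b file (`LcmEuler.eventually_norm_zetaN_sub_one_le`,
which is hard-wired to `W = polymathW x` and the scale `log x`), into ONE normalised quantity
`𝒩_W(u) := u ζ_W(1+u) W/φ(W)` (`LcmEuler.zetaWN`), now for a general modulus `W`:
* `LcmEuler.norm_zetaWN_sub_one_le` — the non-asymptotic estimate `‖𝒩_W(u) − 1‖ ≤ 3ε₁` from the pole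
  of `ζ` (`exists_delta_zeta_pole`) and `∏_{p ∣ W}(1 − p^{−1−u}) = (1 + O(|u| Σ_{p∣W} 1)) φ(W)/W`
  (`exists_prod_primeFactors_eq`);
* `Maynard2016.eventually_norm_zetaWN_Pw_sub_one_le` — for Maynard's `W = P_w`, `w = log₄ x`, and ALL
  `u ≠ 0` with `|u| ≤ c √(log x)/log y` (this covers both scales of Lemma 6: `u = (1+iξ)/log x` and
  `u = (1+iτ)/log y` with `|ξ|, |τ| ≤ √log x`): eventually in `x`, `‖𝒩_{P_w}(u) − 1‖ ≤ η`.
Also `Maynard2016.tendsto_sqrt_log_mul_log₃_div_log_y`: `√(log x) log₃ x / log y → 0`.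

## References

* J. Maynard, *Large gaps between primes*, Ann. of Math. (2) 183 (2016), 915–933; arXiv:1408.5110,
  §6, proof of Lemma 6, displays (6.15), (6.17). [Maynard2016LargeGaps]
* D. H. J. Polymath, *Variants of the Selberg sieve, and bounded intervals containing many primes*,
  Res. Math. Sci. 1 (2014), Art. 12; arXiv:1407.4897, proof of Lemma 4.1, p. 12. [Polymath8b2014]
-/

noncomputable section

open Filter Finset
open scoped BigOperators Topology

namespace Literature.NumberTheory.Sieve

namespace LcmEuler

/-! ### The normalised value `𝒩_W(u) = u ζ_W(1+u) W/φ(W)` -/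

/-- `𝒩_W(u) := u · ζ_W(1+u) / (φ(W)/W)`: the modified zeta value normalised by its asymptotic
`(φ(W)/W)⁻¹ u⁻¹` near `u = 0`. [cite: Maynard2016LargeGaps, §6 display (6.17)] -/
def zetaWN (W : ℕ) (u : ℂ) : ℂ :=
  u * zetaW W (1 + u) / (((Nat.totient W : ℝ) / W : ℝ) : ℂ)

/-- `φ(W)/W ≠ 0` for `W ≠ 0`. [folklore] -/
private theorem totient_div_ne_zero {W : ℕ} (hW : W ≠ 0) :
    ((((Nat.totient W : ℝ) / W : ℝ)) : ℂ) ≠ 0 := by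
  have h1 : (0 : ℝ) < Nat.totient W := Nat.cast_pos.2 (Nat.totient_pos.2 (Nat.pos_of_ne_zero hW))
  have h2 : (0 : ℝ) < W := Nat.cast_pos.2 (Nat.pos_of_ne_zero hW)
  exact_mod_cast (div_pos h1 h2).ne'

/-- `ζ_W(1+u) = 𝒩_W(u) (φ(W)/W) / u`. [cite: Maynard2016LargeGaps, §6 display (6.17)] -/
theorem zetaW_eq_zetaWN {W : ℕ} (hW : W ≠ 0) {u : ℂ} (hu : u ≠ 0) :
    zetaW W (1 + u) = zetaWN W u * (((Nat.totient W : ℝ) / W : ℝ) : ℂ) / u := by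
  have hφ := totient_div_ne_zero hW
  rw [zetaWN]; field_simp

/-- `𝒩_W(u) = (u ζ(1+u)) · ρ` whenever `∏_{p ∣ W}(1 − p^{−1−u}) = (φ(W)/W) ρ`. [cite: Polymath8b2014, Lemma 4.1 (proof, p. 12)] -/
theorem zetaWN_eq {W : ℕ} (hW : W ≠ 0) (u : ℂ) {ρ : ℂ}
    (hρ : ∏ p ∈ W.primeFactors, (1 - (p : ℂ) ^ (-(1 + u))) =
      ((Nat.totient W : ℝ) / W : ℝ) * ρ) :
    zetaWN W u = (u * riemannZeta (1 + u)) * ρ := by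
  have hφ := totient_div_ne_zero hW
  rw [zetaWN, zetaW, hρ]
  field_simp

/-- **`ζ_W(1+u) = (1+O(ε₁)) (W/φ(W))/u`, non-asymptotic form**: if `‖s ζ(1+s) − 1‖ ≤ ε₁` for
`0 < ‖s‖ < δ` (the pole, `exists_delta_zeta_pole`), `0 < ‖u‖ < δ`, `‖u‖ log p ≤ 1` for all `p ∣ W`
and `exp(2‖u‖ #{p ∣ W}) ≤ 1 + ε₁` with `ε₁ ≤ 1`, then `‖𝒩_W(u) − 1‖ ≤ 3ε₁`.
[cite: Maynard2016LargeGaps, §6 displays (6.15), (6.17)] -/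
theorem norm_zetaWN_sub_one_le {ε₁ δ : ℝ} (hε₁ : 0 ≤ ε₁) (hε₁1 : ε₁ ≤ 1)
    (hpole : ∀ s : ℂ, s ≠ 0 → ‖s‖ < δ → ‖s * riemannZeta (1 + s) - 1‖ ≤ ε₁)
    {W : ℕ} (hW : W ≠ 0) {u : ℂ} (hu0 : u ≠ 0) (huδ : ‖u‖ < δ)
    (hlog : ∀ p ∈ W.primeFactors, ‖u‖ * Real.log p ≤ 1)
    (hcard : Real.exp (2 * ‖u‖ * W.primeFactors.card) ≤ 1 + ε₁) :
    ‖zetaWN W u - 1‖ ≤ 3 * ε₁ := by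
  have hA : ‖u * riemannZeta (1 + u) - 1‖ ≤ ε₁ := hpole u hu0 huδ
  obtain ⟨ρ, hρ, hρ1⟩ := exists_prod_primeFactors_eq hW hlog
  have hB : ‖ρ - 1‖ ≤ ε₁ := hρ1.trans (by linarith)
  rw [zetaWN_eq hW u hρ]
  have hρn : ‖ρ‖ ≤ 1 + ε₁ := by
    have := norm_le_norm_add_norm_sub' ρ 1
    rw [norm_one] at this; linarith [norm_sub_rev ρ 1]
  have e : u * riemannZeta (1 + u) * ρ - 1 = (u * riemannZeta (1 + u) - 1) * ρ + (ρ - 1) := by ring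
  rw [e]
  refine (norm_add_le _ _).trans ?_
  rw [norm_mul]
  nlinarith [mul_le_mul hA hρn (norm_nonneg _) hε₁]

end LcmEuler

namespace Maynard2016

open LcmEuler

/-! ### Maynard's modulus `W = P_w` and the cube `|u| ≤ c √(log x)/log y` -/

/-- **`√(log x) · log₃ x / log y → 0`** (`log y = (1−ε) log x log₃ x/log₂ x`, so the quotient is
`log₂ x/((1−ε)√log x)`). [cite: Maynard2016LargeGaps, §2 display (2.1)] -/
theorem tendsto_sqrt_log_mul_log₃_div_log_y {ε : ℝ} (hε : ε < 1) :
    Tendsto (fun x : ℕ => Real.sqrt (Real.log x) * Real.log (Real.log (Real.log x)) /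
      Real.log (y ε x)) atTop (𝓝 0) := by
  have h1 : Tendsto (fun x : ℕ => (1 - ε)⁻¹ * (Real.log (Real.log (x : ℝ)) /
      Real.sqrt (Real.log (x : ℝ)))) atTop (𝓝 0) := by
    have h := (tendsto_loglog_div_sqrt_log.comp tendsto_natCast_atTop_atTop).const_mul (1 - ε)⁻¹
    rw [mul_zero] at h
    exact h
  refine h1.congr' ?_
  filter_upwards [eventually_iteratedLogs] with x hx
  obtain ⟨hL, hL₂, hL₃, -, -, -, -⟩ := hx
  have hL0 : 0 < Real.log x := by linarith
  have hsqrt : 0 < Real.sqrt (Real.log x) := Real.sqrt_pos.2 hL0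
  have hsq : Real.sqrt (Real.log x) * Real.sqrt (Real.log x) = Real.log x := Real.mul_self_sqrt hL0.le
  have hε' : (1 - ε) ≠ 0 := by linarith
  rw [log_y]
  field_simp
  nlinarith [hsq]

/-- For `p ∣ P_w`: `p` is a prime `≤ ⌊w⌋`. [cite: Maynard2016LargeGaps, §4 (definition of P_w)] -/
theorem le_floor_wFun_of_mem_primeFactors_Pw {x p : ℕ} (hp : p ∈ (Pw x).primeFactors) :
    p.Prime ∧ p ≤ ⌊wFun x⌋₊ := by
  have hpp := Nat.prime_of_mem_primeFactors hp
  refine ⟨hpp, ?_⟩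
  have h := Nat.dvd_of_mem_primeFactors hp
  unfold Pw at h
  exact hpp.dvd_primorial_iff.1 h

/-- `#{p ∣ P_w} ≤ ⌊w⌋`. [cite: Maynard2016LargeGaps, §4 (definition of P_w)] -/
theorem card_primeFactors_Pw_le (x : ℕ) : ((Pw x).primeFactors.card : ℝ) ≤ ⌊wFun x⌋₊ := by
  have hsub : (Pw x).primeFactors ⊆ Finset.Icc 1 ⌊wFun x⌋₊ := by
    intro p hp
    obtain ⟨hpp, hle⟩ := le_floor_wFun_of_mem_primeFactors_Pw hp
    exact Finset.mem_Icc.2 ⟨hpp.one_lt.le, hle⟩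
  have := Finset.card_le_card hsub
  rw [Nat.card_Icc] at this
  exact_mod_cast (by omega : (Pw x).primeFactors.card ≤ ⌊wFun x⌋₊)

/-- `P_w ≠ 0`. [cite: Maynard2016LargeGaps, §4 (definition of P_w)] -/
theorem Pw_ne_zero (x : ℕ) : Pw x ≠ 0 := (primorial_pos _).ne'

/-- **`ζ_{P_w}(1+u) = (1+o(1)) (P_w/φ(P_w))/u` uniformly for `0 < |u| ≤ c √(log x)/log y`**
((6.15) + (6.17): the pole of `ζ`, and `∏_{p ≤ w}(1 − p^{−1−u}) = (1+o(1)) ∏_{p ≤ w}(1 − 1/p)` since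
`|u| log w → 0`): for every `η > 0` and `c`, eventually in `x`, `‖𝒩_{P_w}(u) − 1‖ ≤ η` for all such `u`.
[cite: Maynard2016LargeGaps, §6 displays (6.15), (6.17)] -/
theorem eventually_norm_zetaWN_Pw_sub_one_le {ε : ℝ} (hε : ε < 1) {η : ℝ} (hη : 0 < η) (c : ℝ) :
    ∀ᶠ x : ℕ in atTop, ∀ u : ℂ, u ≠ 0 →
      ‖u‖ ≤ c * Real.sqrt (Real.log x) / Real.log (y ε x) → ‖zetaWN (Pw x) u - 1‖ ≤ η := by
  -- constants
  set ε₁ : ℝ := min η 1 / 3 with hε₁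
  have hε₁pos : 0 < ε₁ := by positivity
  have hε₁le : ε₁ ≤ 1 := by rw [hε₁]; linarith [min_le_right η 1]
  have h3ε₁ : 3 * ε₁ ≤ η := by rw [hε₁]; linarith [min_le_left η 1]
  obtain ⟨δ, hδ, hpole⟩ := exists_delta_zeta_pole hε₁pos
  set c' : ℝ := |c| + 1 with hc'
  have hc'pos : 0 < c' := by positivity
  -- the small parameter `ρ(x) = c' √(log x) log₃ x / log y → 0`
  have hρ : Tendsto (fun x : ℕ => c' * (Real.sqrt (Real.log x) * Real.log (Real.log (Real.log x)) /
      Real.log (y ε x))) atTop (𝓝 0) := by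
    simpa using (tendsto_sqrt_log_mul_log₃_div_log_y hε).const_mul c'
  have hexp : Tendsto (fun x : ℕ => Real.exp (2 * (c' * (Real.sqrt (Real.log x) *
      Real.log (Real.log (Real.log x)) / Real.log (y ε x))))) atTop (𝓝 1) := by
    have h2 := hρ.const_mul 2
    rw [mul_zero] at h2
    have h := (Real.continuous_exp.tendsto 0).comp h2
    rw [Real.exp_zero] at h
    exact h
  filter_upwards [eventually_iteratedLogs, hρ.eventually_lt_const hδ,
    hρ.eventually_le_const (show (0 : ℝ) < 1 by norm_num),
    hexp.eventually_le_const (show (1 : ℝ) < 1 + ε₁ by linarith),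
    (tendsto_sqrt_log_mul_log₃_div_log_y hε).eventually_le_const (show (0 : ℝ) < 1 by norm_num)]
    with x hx hρδ hρ1 hexp1 _
  obtain ⟨hL, hL₂, hL₃, hL₃L₂, hL₂L, -, -⟩ := hx
  intro u hu0 hun
  set L₃ := Real.log (Real.log (Real.log x)) with hL₃def
  have hL0 : 0 < Real.log x := by linarith
  have hsqrt : 0 < Real.sqrt (Real.log x) := Real.sqrt_pos.2 hL0
  have hly : 0 < Real.log (y ε x) := by
    rw [log_y]
    exact mul_pos (by linarith) (div_pos (mul_pos hL0 (by linarith)) (by linarith))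
  have hL₃1 : 1 ≤ L₃ := hL₃
  -- `‖u‖ ≤ c' √log x/log y` and `‖u‖ L₃ ≤ ρ(x)`
  have hun' : ‖u‖ ≤ c' * (Real.sqrt (Real.log x) / Real.log (y ε x)) := by
    refine hun.trans ?_
    rw [mul_div_assoc]
    exact mul_le_mul_of_nonneg_right (by rw [hc']; linarith [le_abs_self c]) (by positivity)
  have huL₃ : ‖u‖ * L₃ ≤ c' * (Real.sqrt (Real.log x) * L₃ / Real.log (y ε x)) := by
    have := mul_le_mul_of_nonneg_right hun' (by linarith : (0 : ℝ) ≤ L₃)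
    refine this.trans (le_of_eq ?_)
    rw [hL₃def]; ring
  have hu1 : ‖u‖ ≤ c' * (Real.sqrt (Real.log x) * L₃ / Real.log (y ε x)) := by
    have h0 : 0 ≤ ‖u‖ := norm_nonneg u
    nlinarith
  -- (a) `‖u‖ < δ`
  have huδ : ‖u‖ < δ := lt_of_le_of_lt hu1 hρδ
  -- (b) `‖u‖ log p ≤ 1` for `p ∣ P_w` (`log p ≤ p ≤ w ≤ log₃ x − 1`)
  have hw : wFun x ≤ L₃ - 1 := wFun_le (by linarith)
  have hfloor : (⌊wFun x⌋₊ : ℝ) ≤ L₃ := by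
    have h0 : 0 ≤ wFun x := wFun_nonneg hL₃1
    linarith [Nat.floor_le h0]
  have hlogp : ∀ p ∈ (Pw x).primeFactors, ‖u‖ * Real.log p ≤ 1 := by
    intro p hp
    obtain ⟨hpp, hple⟩ := le_floor_wFun_of_mem_primeFactors_Pw hp
    have hp0 : (0 : ℝ) < p := by exact_mod_cast hpp.pos
    have hlogp : Real.log p ≤ L₃ := by
      have h1 : Real.log p ≤ p - 1 := Real.log_le_sub_one_of_pos hp0
      have h2 : (p : ℝ) ≤ ⌊wFun x⌋₊ := by exact_mod_cast hple
      linarith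
    calc ‖u‖ * Real.log p ≤ ‖u‖ * L₃ := mul_le_mul_of_nonneg_left hlogp (norm_nonneg u)
      _ ≤ 1 := huL₃.trans hρ1
  -- (c) `exp(2‖u‖ #{p ∣ P_w}) ≤ 1 + ε₁`
  have hcard : Real.exp (2 * ‖u‖ * (Pw x).primeFactors.card) ≤ 1 + ε₁ := by
    refine le_trans (Real.exp_le_exp.2 ?_) hexp1
    have h1 := card_primeFactors_Pw_le x
    have h0 : 0 ≤ ‖u‖ := norm_nonneg u
    calc 2 * ‖u‖ * ((Pw x).primeFactors.card : ℝ) ≤ 2 * (‖u‖ * L₃) := by nlinarith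
      _ ≤ 2 * (c' * (Real.sqrt (Real.log x) * L₃ / Real.log (y ε x))) := by linarith
  exact (norm_zetaWN_sub_one_le hε₁pos.le hε₁le hpole (Pw_ne_zero x) hu0 huδ hlogp hcard).trans h3ε₁

end Maynard2016

end Literature.NumberTheory.Sieve

end
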